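import Literature.MathematicalPhysics.QuantumFieldTheory.Balaban1983to89.B6VecIMSV1
import Literature.MathematicalPhysics.QuantumFieldTheory.Balaban1983to89.B6RandomWalkL2
import Literature.MathematicalPhysics.QuantumFieldTheory.Balaban1983to89.B6GDVaLegKLevelV1
import HarnessLib

/-!
# `Balaban1983to89.B6IMSTermsV1` — T. Bałaban, *Propagators and renormalization transformations for lattice gauge theories. II*,
Commun. Math. Phys. **96** (1984) 223–250 [Balaban1984PropagatorsII], Prop. 2.6 (2.140) p. 247 with (2.5) p. 224 and [Balaban1984PropagatorsI]
(1.21) p. 21: **THE FOUR TERMS OF THE LOCALISED ENERGY IDENTITY, BOUNDED IN BLOCK-`ℓ²` FORM** — file F4a of the interior-energy route to (2.140)₄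
(`‖h_□ ∇G(𝔅)∇* h_□′‖`, census slot hl3 of `B6Prop26PrintedStage2KLevelV1.prop26Printed_kLevel_of_slots5`; cell pub-ymgap, seat dag-p1,
`HOME/pub-ymgap-dag-p1/HL3-PLAN.md`; lit-balaban GAPS G-B6-2140-456).
HONEST FRAMING (programme rule): statement-level skeleton of published theorems with citation tags; proofs where landed; nothing here is a claim about
the Yang–Mills mass gap.  Elementary `ℓ²` bookkeeping (Cauchy–Schwarz, summation by parts, AM–GM) around the identity `B6VecIMSV1.ims_deltaAE`; no
estimate of print is asserted; THEOREMS ONLY; nothing continuum ∕ mass-gap ∕ Clay.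
WHAT IS PROVED (0 sorry; standard axioms): §1 block-`ℓ²` calculus — `abs_sum_mul_le_l2n` (Cauchy–Schwarz), `l2n_blockPiece_apply_le` and
**`abs_sum_mul_apply_le`** (`|Σ φ·Sv| ≤ Σ_{y₁} ‖Δ(y₁)φ‖ Σ_{y₂} K(y₁,y₂)‖Δ(y₂)v‖` from an `ℓ²` majorant `K` of `S`), `hasL2Majorant_of_sigma` (the printed
Σ-shape of (2.140) gives back the block majorant), `l2n_blockPiece_mono`, `l2n_blockPiece_eq_zero`; §2 the error and source terms — `sum_bshift`,
**`abs_E1_le`** (`|Σ_ν Σ_b c²(χ(b+e_ν)−χ(b))² v(b)v(b+e_ν)| ≤ c²δχ²·D·Σ_{N} v²`), `DV_chiSq_apply`, `sum_chiSq_mul_DVa_eq`, **`abs_src_le`**, `src_eq_zero`;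
§3 `sum_sq_DV_le_ims` (the block piece of `∇_ν v` is dominated by the left side of the identity when `χ = 1` there), `le_add_sqrt_mul_of_sq_le`
(closing `X² ≤ aX + BE²`).  Seat `pub-ymgap-dag-p1` (prover), 2026-08-25.  NOT summit progress.
-/

open scoped BigOperators

noncomputable section

namespace Literature.MathematicalPhysics.QuantumFieldTheory.Balaban1983to89.B6IMSTermsV1

open Finset
open LatticeFieldCalculus B6SectADomainsV1 B6SectAOperatorsV1 B6SectAVectorModelV1
open B6RandomWalk (blockPiece sum_blockPiece)
open B6RandomWalkL2 (l2n l2n_sq l2n_nonneg l2n_sum_le l2n_mono blockPiece_sum blockPiece_off HasL2Majorant)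
open B6GradLegKLevelV1 (DV DV_apply)
open B6LapLegKLevelV1 (DVa)
open B6GDVaLegKLevelV1 (tr_DV)
open B6OpTransposeV1 (tr dot_tr)

/-! ## §1  Block-`ℓ²` calculus -/

section L2

variable {g : B6.Geometry} {X : Type} [Fintype X] (blk : X → g.Site)

omit blk in
/-- Cauchy–Schwarz: `|Σ_x f(x)h(x)| ≤ ‖f‖·‖h‖`. [cite: Balaban1984PropagatorsII, (2.140) p.247 (the norm ‖·‖), bookkeeping] -/
theorem abs_sum_mul_le_l2n (f h : X → ℝ) : |∑ x, f x * h x| ≤ l2n f * l2n h := by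
  have hcs := Finset.sum_mul_sq_le_sq_mul_sq Finset.univ f h
  have h2 : (∑ x, f x * h x) ^ 2 ≤ (l2n f * l2n h) ^ 2 := by rw [mul_pow, l2n_sq, l2n_sq]; exact hcs
  have := Real.sqrt_le_sqrt h2
  rwa [Real.sqrt_sq_eq_abs, Real.sqrt_sq (mul_nonneg (l2n_nonneg f) (l2n_nonneg h))] at this

/-- the piece `Δ(y₁)(Sv)` through the majorant: `‖Δ(y₁)Sv‖ ≤ Σ_{y₂} K(y₁,y₂)‖Δ(y₂)v‖`. [cite: Balaban1984PropagatorsII, (2.52) p.232, (2.140) p.247] -/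
theorem l2n_blockPiece_apply_le {S : Module.End ℝ (X → ℝ)} {K : g.Site → g.Site → ℝ} (hS : HasL2Majorant blk S K)
    (y₁ : g.Site) (v : X → ℝ) :
    l2n (blockPiece blk y₁ (S v)) ≤ ∑ y₂ : g.Site, K y₁ y₂ * l2n (blockPiece blk y₂ v) := by
  letI := g.fin
  have hv : S v = ∑ y₂ : g.Site, S (blockPiece blk y₂ v) := by
    rw [← map_sum, sum_blockPiece]
  rw [hv, blockPiece_sum]
  exact (l2n_sum_le _ _).trans (Finset.sum_le_sum fun y₂ _ => hS y₁ y₂ _ (blockPiece_off blk y₂ v))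

/-- **`|Σ_x φ(x)(Sv)(x)| ≤ Σ_{y₁} ‖Δ(y₁)φ‖·Σ_{y₂} K(y₁,y₂)‖Δ(y₂)v‖`** for an `ℓ²` block majorant `K ≥ 0` of `S`.
[cite: Balaban1984PropagatorsII, (2.52) p.232, Prop. 2.6 (2.140) p.247] -/
theorem abs_sum_mul_apply_le {S : Module.End ℝ (X → ℝ)} {K : g.Site → g.Site → ℝ} (hS : HasL2Majorant blk S K)
    (φ v : X → ℝ) :
    |∑ x, φ x * S v x| ≤ ∑ y₁ : g.Site, l2n (blockPiece blk y₁ φ) * ∑ y₂ : g.Site, K y₁ y₂ * l2n (blockPiece blk y₂ v) := by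
  letI := g.fin
  classical
  have h1 : ∑ x, φ x * S v x = ∑ y₁ : g.Site, ∑ x, blockPiece blk y₁ φ x * blockPiece blk y₁ (S v) x := by
    rw [Finset.sum_comm]
    refine Finset.sum_congr rfl fun x _ => ?_
    rw [Finset.sum_eq_single (blk x) (fun y _ hy => by simp [blockPiece, Ne.symm hy]) (fun h => (h (Finset.mem_univ _)).elim)]
    simp [blockPiece]
  rw [h1]
  refine (Finset.abs_sum_le_sum_abs _ _).trans (Finset.sum_le_sum fun y₁ _ => ?_)
  exact (abs_sum_mul_le_l2n _ _).trans
    (mul_le_mul_of_nonneg_left (l2n_blockPiece_apply_le blk hS y₁ v) (l2n_nonneg _))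

/-- THE PRINTED Σ-SHAPE OF (2.140) GIVES BACK THE BLOCK MAJORANT (take `ζ = 1_{Δ(y)}`, `s = 1`).
[cite: Balaban1984PropagatorsII, Prop. 2.6 (2.140) p.247] -/
theorem hasL2Majorant_of_sigma {T : Module.End ℝ (X → ℝ)} {K : g.Site → g.Site → ℝ} (hK : ∀ y y', 0 ≤ K y y')
    (h : ∀ (y y' : g.Site) (ζ J : X → ℝ) {s : ℝ}, 0 ≤ s → (∀ x, blk x ≠ y → ζ x = 0) → (∀ x, |ζ x| ≤ s) →
      (∀ x, blk x ≠ y' → J x = 0) → ∑ x, (ζ x * T J x) ^ 2 ≤ (K y y' * s) ^ 2 * ∑ x, J x ^ 2) :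
    HasL2Majorant blk T K := by
  classical
  intro y y' u hu
  have h1 := h y y' (fun x => if blk x = y then 1 else 0) u zero_le_one (fun x hx => if_neg hx)
    (fun x => by split_ifs <;> simp) hu
  have h2 : ∑ x, ((fun x => if blk x = y then (1 : ℝ) else 0) x * T u x) ^ 2 = l2n (blockPiece blk y (T u)) ^ 2 := by
    rw [l2n_sq]; refine Finset.sum_congr rfl fun x _ => ?_; simp only [blockPiece]; split_ifs <;> simp
  rw [h2, mul_one, ← l2n_sq, ← mul_pow] at h1
  exact (pow_le_pow_iff_left₀ (l2n_nonneg _) (mul_nonneg (hK y y') (l2n_nonneg u)) two_ne_zero).1 h1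

omit [Fintype X] in
/-- monotonicity of a block piece under pointwise domination. [cite: Balaban1984PropagatorsII, (2.52) p.232, bookkeeping] -/
theorem l2n_blockPiece_mono [Fintype X] (y : g.Site) {φ v : X → ℝ} (h : ∀ x, |φ x| ≤ |v x|) :
    l2n (blockPiece blk y φ) ≤ l2n (blockPiece blk y v) :=
  l2n_mono fun x => by unfold blockPiece; split_ifs <;> simp [h x]

omit [Fintype X] in
/-- a block piece of a function vanishing on that block is `0`. [cite: Balaban1984PropagatorsII, (2.52) p.232, bookkeeping] -/
theorem l2n_blockPiece_eq_zero [Fintype X] (y : g.Site) {φ : X → ℝ} (h : ∀ x, blk x = y → φ x = 0) :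
    l2n (blockPiece blk y φ) = 0 := by
  have : blockPiece blk y φ = 0 := funext fun x => by unfold blockPiece; split_ifs with hx <;> simp [h x, hx]
  rw [this]; exact norm_zero

end L2

/-! ## §2  The error term `E₁` and the source term -/

section Bonds

variable {P : Params}

/-- reindexing a bond sum by `b ↦ b + e_ν`. [cite: Balaban1984PropagatorsI, (1.21) p.21, bookkeeping] -/
theorem sum_bshift {α : Type*} [AddCommMonoid α] (ν : Fin P.d) (F : PBond P 0 → α) :
    ∑ b : PBond P 0, F ⟨b.src.shift ν, b.dir⟩ = ∑ b : PBond P 0, F b := by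
  let e : PBond P 0 ≃ PBond P 0 :=
    (LatticeFieldCalculus.bondEquiv (P := P) (j := 0)).symm.trans
      (((shiftEquiv (P := P) (j := 0) ν).prodCongr (Equiv.refl (Fin P.d))).trans
        (LatticeFieldCalculus.bondEquiv (P := P) (j := 0)))
  exact Equiv.sum_comp e F

/-- **THE ERROR TERM**: if `|χ(b+e_ν) − χ(b)| ≤ δχ` everywhere and `χ(b+e_ν) ≠ χ(b)` forces both `b` and `b + e_ν` into the set `N`, then
`|Σ_ν Σ_b c²(χ(b+e_ν)−χ(b))²·v(b)v(b+e_ν)| ≤ c²·δχ²·D·Σ_{b ∈ N} v(b)²` (AM–GM and a reindexing).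
[cite: Balaban1984PropagatorsII, Prop. 2.6 (2.140) p.247; Balaban1984PropagatorsI, (1.21) p.21] -/
theorem abs_E1_le (c δχ : ℝ) (v χ : PBond P 0 → ℝ) (N : PBond P 0 → Prop) [DecidablePred N]
    (hLip : ∀ (b : PBond P 0) (ν : Fin P.d), |χ ⟨b.src.shift ν, b.dir⟩ - χ b| ≤ δχ)
    (hN : ∀ (b : PBond P 0) (ν : Fin P.d), χ ⟨b.src.shift ν, b.dir⟩ ≠ χ b → N b ∧ N ⟨b.src.shift ν, b.dir⟩) :
    |∑ ν : Fin P.d, ∑ b : PBond P 0, c ^ 2 * (χ ⟨b.src.shift ν, b.dir⟩ - χ b) ^ 2 * (v b * v ⟨b.src.shift ν, b.dir⟩)| ≤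
      c ^ 2 * δχ ^ 2 * (P.d : ℝ) * ∑ b : PBond P 0, (if N b then v b ^ 2 else 0) := by
  set S : ℝ := ∑ b : PBond P 0, (if N b then v b ^ 2 else 0) with hS
  have hS0 : 0 ≤ S := Finset.sum_nonneg fun b _ => by split_ifs <;> positivity
  have hν : ∀ ν : Fin P.d,
      |∑ b : PBond P 0, c ^ 2 * (χ ⟨b.src.shift ν, b.dir⟩ - χ b) ^ 2 * (v b * v ⟨b.src.shift ν, b.dir⟩)| ≤ c ^ 2 * δχ ^ 2 * S := by
    intro ν
    have hpt : ∀ b : PBond P 0, |c ^ 2 * (χ ⟨b.src.shift ν, b.dir⟩ - χ b) ^ 2 * (v b * v ⟨b.src.shift ν, b.dir⟩)| ≤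
        c ^ 2 * δχ ^ 2 * (((if N b then v b ^ 2 else 0) + (if N ⟨b.src.shift ν, b.dir⟩ then v ⟨b.src.shift ν, b.dir⟩ ^ 2 else 0)) / 2) := by
      intro b
      by_cases hb : χ ⟨b.src.shift ν, b.dir⟩ = χ b
      · rw [hb, sub_self]; simp only [ne_eq, OfNat.ofNat_ne_zero, not_false_eq_true, zero_pow, mul_zero, zero_mul, abs_zero]
        refine mul_nonneg (by positivity) (div_nonneg (add_nonneg ?_ ?_) (by norm_num)) <;> split_ifs <;> positivity
      · obtain ⟨h1, h2⟩ := hN b ν hb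
        rw [if_pos h1, if_pos h2, abs_mul, abs_mul, abs_of_nonneg (sq_nonneg c), abs_of_nonneg (sq_nonneg _)]
        have hsq : (χ ⟨b.src.shift ν, b.dir⟩ - χ b) ^ 2 ≤ δχ ^ 2 := by
          have := hLip b ν
          rw [← sq_abs]; exact pow_le_pow_left₀ (abs_nonneg _) this 2
        have ham : |v b * v ⟨b.src.shift ν, b.dir⟩| ≤ (v b ^ 2 + v ⟨b.src.shift ν, b.dir⟩ ^ 2) / 2 := by
          rw [abs_mul]
          nlinarith [sq_nonneg (|v b| - |v ⟨b.src.shift ν, b.dir⟩|), sq_abs (v b), sq_abs (v ⟨b.src.shift ν, b.dir⟩),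
            abs_nonneg (v b), abs_nonneg (v ⟨b.src.shift ν, b.dir⟩)]
        calc c ^ 2 * (χ ⟨b.src.shift ν, b.dir⟩ - χ b) ^ 2 * |v b * v ⟨b.src.shift ν, b.dir⟩|
            ≤ c ^ 2 * δχ ^ 2 * ((v b ^ 2 + v ⟨b.src.shift ν, b.dir⟩ ^ 2) / 2) := by
              gcongr
        _ = _ := rfl
    refine (Finset.abs_sum_le_sum_abs _ _).trans ((Finset.sum_le_sum fun b _ => hpt b).trans (le_of_eq ?_))
    rw [← Finset.mul_sum, ← Finset.sum_div, Finset.sum_add_distrib,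
      sum_bshift ν (fun b : PBond P 0 => if N b then v b ^ 2 else 0)]
    rw [hS]; ring
  calc |∑ ν : Fin P.d, ∑ b : PBond P 0, c ^ 2 * (χ ⟨b.src.shift ν, b.dir⟩ - χ b) ^ 2 * (v b * v ⟨b.src.shift ν, b.dir⟩)|
      ≤ ∑ ν : Fin P.d, c ^ 2 * δχ ^ 2 * S := (Finset.abs_sum_le_sum_abs _ _).trans (Finset.sum_le_sum fun ν _ => hν ν)
    _ = c ^ 2 * δχ ^ 2 * (P.d : ℝ) * S := by rw [Finset.sum_const, Finset.card_univ, Fintype.card_fin, nsmul_eq_mul]; ring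

/-- `∇_μ(χ²v)(b) = χ(b+e_μ)·c(χv(b+e_μ) − χv(b)) + χ(b)v(b)·c(χ(b+e_μ) − χ(b))`. [cite: Balaban1984PropagatorsI, (1.4) p.18, bookkeeping] -/
theorem DV_chiSq_apply (μ : Fin P.d) (c : ℝ) (χ v : PBond P 0 → ℝ) (b : PBond P 0) :
    DV μ c (fun b => χ b ^ 2 * v b) b =
      χ ⟨b.src.shift μ, b.dir⟩ * (c * (χ ⟨b.src.shift μ, b.dir⟩ * v ⟨b.src.shift μ, b.dir⟩ - χ b * v b)) +
        χ b * v b * (c * (χ ⟨b.src.shift μ, b.dir⟩ - χ b)) := by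
  rw [DV_apply]; ring

/-- SUMMATION BY PARTS for the source pairing: `Σ_b χ²v(b)·(∇*_μ u)(b) = Σ_b ∇_μ(χ²v)(b)·u(b)`.
[cite: Balaban1984PropagatorsI, (1.21) p.21] -/
theorem sum_chiSq_mul_DVa_eq (μ : Fin P.d) (c : ℝ) (χ v u : PBond P 0 → ℝ) :
    ∑ b, χ b ^ 2 * v b * DVa μ c u b = ∑ b, DV μ c (fun b => χ b ^ 2 * v b) b * u b := by
  have h := dot_tr (DV μ c) u (fun b => χ b ^ 2 * v b)
  rw [tr_DV, dotProduct, dotProduct] at h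
  calc ∑ b, χ b ^ 2 * v b * DVa μ c u b = ∑ b, DVa μ c u b * (χ b ^ 2 * v b) := Finset.sum_congr rfl fun b _ => by ring
    _ = ∑ b, u b * DV μ c (fun b => χ b ^ 2 * v b) b := h
    _ = _ := Finset.sum_congr rfl fun b _ => by ring

/-- **THE SOURCE TERM**: for `0 ≤ χ ≤ 1` with `|χ(b+e_μ) − χ(b)| ≤ δχ`,
`|Σ_b χ²v·∇*_μu| ≤ (‖b ↦ c(χv(b+e_μ)−χv(b))‖ + |c|δχ‖1_{χ(·+e_μ)≠χ}·v‖)·‖u‖`.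
[cite: Balaban1984PropagatorsII, Prop. 2.6 (2.140) p.247; Balaban1984PropagatorsI, (1.21) p.21] -/
theorem abs_src_le (μ : Fin P.d) (c : ℝ) {δχ : ℝ} (hδ : 0 ≤ δχ) (χ v u : PBond P 0 → ℝ)
    (hχ : ∀ b, 0 ≤ χ b ∧ χ b ≤ 1) (hLip : ∀ (b : PBond P 0), |χ ⟨b.src.shift μ, b.dir⟩ - χ b| ≤ δχ) :
    |∑ b, χ b ^ 2 * v b * DVa μ c u b| ≤
      (l2n (fun b : PBond P 0 => c * (χ ⟨b.src.shift μ, b.dir⟩ * v ⟨b.src.shift μ, b.dir⟩ - χ b * v b)) +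
        |c| * δχ * l2n (fun b : PBond P 0 => if χ ⟨b.src.shift μ, b.dir⟩ = χ b then 0 else v b)) * l2n u := by
  classical
  rw [sum_chiSq_mul_DVa_eq]
  set X : PBond P 0 → ℝ := fun b => c * (χ ⟨b.src.shift μ, b.dir⟩ * v ⟨b.src.shift μ, b.dir⟩ - χ b * v b) with hX
  set Y : PBond P 0 → ℝ := fun b => if χ ⟨b.src.shift μ, b.dir⟩ = χ b then 0 else v b with hY
  have hsplit : ∀ b, DV μ c (fun b => χ b ^ 2 * v b) b * u b =
      (χ ⟨b.src.shift μ, b.dir⟩ * X b) * u b + (χ b * (c * (χ ⟨b.src.shift μ, b.dir⟩ - χ b)) * Y b) * u b := by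
    intro b
    rw [DV_chiSq_apply, hX, hY]; simp only
    split_ifs with h
    · rw [h, sub_self]; ring
    · ring
  rw [Finset.sum_congr rfl fun b _ => hsplit b, Finset.sum_add_distrib]
  refine (abs_add_le _ _).trans ?_
  rw [add_mul]
  refine add_le_add ?_ ?_
  · refine (abs_sum_mul_le_l2n _ _).trans (mul_le_mul_of_nonneg_right (l2n_mono fun b => ?_) (l2n_nonneg u))
    rw [abs_mul]
    calc |χ ⟨b.src.shift μ, b.dir⟩| * |X b| ≤ 1 * |X b| := by
          refine mul_le_mul_of_nonneg_right ?_ (abs_nonneg _)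
          rw [abs_of_nonneg (hχ _).1]; exact (hχ _).2
      _ = |X b| := one_mul _
  · refine (abs_sum_mul_le_l2n _ _).trans (mul_le_mul_of_nonneg_right ?_ (l2n_nonneg u))
    have h1 : l2n (fun b => χ b * (c * (χ ⟨b.src.shift μ, b.dir⟩ - χ b)) * Y b) ≤ l2n ((|c| * δχ) • Y) := by
      refine l2n_mono fun b => ?_
      rw [Pi.smul_apply, smul_eq_mul, abs_mul, abs_mul, abs_mul, abs_mul, abs_of_nonneg (mul_nonneg (abs_nonneg c) hδ)]
      have h2 : |χ b| ≤ 1 := by rw [abs_of_nonneg (hχ b).1]; exact (hχ b).2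
      have h3 := hLip b
      calc |χ b| * (|c| * |χ ⟨b.src.shift μ, b.dir⟩ - χ b|) * |Y b| ≤ 1 * (|c| * δχ) * |Y b| := by
            gcongr
        _ = |c| * δχ * |Y b| := by ring
    refine h1.trans (le_of_eq ?_)
    rw [B6RandomWalkL2.l2n_smul, abs_of_nonneg (mul_nonneg (abs_nonneg c) hδ)]

/-- the source pairing VANISHES when `χ` and its `μ`-translate vanish on the block carrying `u`.
[cite: Balaban1984PropagatorsII, Prop. 2.6 (2.140) p.247, bookkeeping] -/
theorem src_eq_zero {Y : Type} (blk : PBond P 0 → Y) (y' : Y) (μ : Fin P.d) (c : ℝ) (χ v u : PBond P 0 → ℝ)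
    (hχ : ∀ b, blk b = y' → χ b = 0 ∧ χ ⟨b.src.shift μ, b.dir⟩ = 0) (hu : ∀ b, blk b ≠ y' → u b = 0) :
    ∑ b, χ b ^ 2 * v b * DVa μ c u b = 0 := by
  rw [sum_chiSq_mul_DVa_eq]
  refine Finset.sum_eq_zero fun b _ => ?_
  by_cases hb : blk b = y'
  · rw [DV_chiSq_apply, (hχ b hb).1, (hχ b hb).2]; ring
  · rw [hu b hb, mul_zero]

end Bonds

/-! ## §3  The block piece of `∇_ν v` against the left side; closing the quadratic inequality -/

section Close

variable {P : Params}

/-- if `χ = 1` on the bonds of a set `Y` and on their `ν`-translates, the `Y`-piece of `‖∇_ν v‖²` is at most the `ν`-th term of the left side of the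
localised identity. [cite: Balaban1984PropagatorsII, Prop. 2.6 (2.140) p.247, bookkeeping] -/
theorem sum_sq_DV_le_ims (ν : Fin P.d) (c : ℝ) (χ v : PBond P 0 → ℝ) (Y : PBond P 0 → Prop) [DecidablePred Y]
    (hY : ∀ b, Y b → χ b = 1 ∧ χ ⟨b.src.shift ν, b.dir⟩ = 1) :
    ∑ b, (if Y b then DV ν c v b else 0) ^ 2 ≤
      ∑ ν' : Fin P.d, ∑ b : PBond P 0, (c * (χ ⟨b.src.shift ν', b.dir⟩ * v ⟨b.src.shift ν', b.dir⟩ - χ b * v b)) ^ 2 := by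
  calc ∑ b, (if Y b then DV ν c v b else 0) ^ 2
      ≤ ∑ b : PBond P 0, (c * (χ ⟨b.src.shift ν, b.dir⟩ * v ⟨b.src.shift ν, b.dir⟩ - χ b * v b)) ^ 2 :=
        Finset.sum_le_sum fun b _ => by
          split_ifs with hb
          · rw [DV_apply, (hY b hb).1, (hY b hb).2, one_mul, one_mul]
          · simp only [ne_eq, OfNat.ofNat_ne_zero, not_false_eq_true, zero_pow]; positivity
    _ ≤ _ := Finset.single_le_sum (f := fun ν' : Fin P.d => ∑ b : PBond P 0,
          (c * (χ ⟨b.src.shift ν', b.dir⟩ * v ⟨b.src.shift ν', b.dir⟩ - χ b * v b)) ^ 2)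
        (fun ν' _ => Finset.sum_nonneg fun b _ => sq_nonneg _) (Finset.mem_univ ν)

/-- closing `X² ≤ aX + BE²` (`a, B, E ≥ 0`): `X ≤ a + √B·E` — the form in which the localised energy inequality is closed.
[cite: Balaban1984PropagatorsII, Prop. 2.6 (2.140) p.247, bookkeeping] -/
theorem le_add_sqrt_mul_of_sq_le {X a B E : ℝ} (ha : 0 ≤ a) (hB : 0 ≤ B) (hE : 0 ≤ E) (h : X ^ 2 ≤ a * X + B * E ^ 2) :
    X ≤ a + Real.sqrt B * E := by
  by_contra hlt
  rw [not_le] at hlt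
  have hs := Real.sq_sqrt hB
  have hs0 := Real.sqrt_nonneg B
  have hBE : B * E ^ 2 = (Real.sqrt B * E) ^ 2 := by rw [mul_pow, hs]
  rw [hBE] at h
  have hsE : 0 ≤ Real.sqrt B * E := mul_nonneg hs0 hE
  nlinarith [mul_pos (by linarith : 0 < X - a - Real.sqrt B * E) (by linarith : 0 < X + Real.sqrt B * E)]

end Close

end Literature.MathematicalPhysics.QuantumFieldTheory.Balaban1983to89.B6IMSTermsV1
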